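import Summits.ResolutionOfSingularities.ResolutionOfSingularities.Theorems.FrobeniusClosingPatchingRelPerfectCoreRungReductions
import Literature.AlgebraicGeometry.Resolution.ExceptionalDivisorProjectiveBundle
import Literature.AlgebraicGeometry.Resolution.SpreadRestrict
import Literature.AlgebraicGeometry.Resolution.RsopMonomialIdeals
import Literature.AlgebraicGeometry.Resolution.NodalBlowupChartAlgebra
import HarnessLib

/-!
# Crux `PatchingRelPerfect` (stmt-ResolutionOfSingularities-16161), chain w52 — CORE RUNG r1b:
# the blow-up-form open core ONE LINEAR CENTRE UP
# (`(u₁ᵃ, …, u_nᵃ) · P ⊆ I ⊆ 𝔪ᵃ · P`, `P` part of a regular system of parameters)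

[OURS · L1 W5.2 · rung] Rung r1a (`CoreRungReductions`) settled the blow-up-form open core
`AtomDimFourBlowupAt` (companion form, W2) on the reductions of powers of `𝔪`, where the blowing
up `T = Bl_I Spec S` is an isomorphism off the closed point.  This file lands the first family on
which the atom's hypothesis "regular off the closed fibre" is exercised NON-vacuously: `S` regular
local, `𝔪 = (u₁, …, u_n)`, `P = (x₀, …, x_r) ⊆ 𝔪` generated by part of a regular system of
parameters (more generally: quasi-regular with `S/P` regular), and
`(u₁ᵃ, …, u_nᵃ) · P ⊆ I ⊆ 𝔪ᵃ · P` — e.g. `n = 4`, `P = (u₁, u₂, u₃)`, `a = 1`,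
`I = (u₁², u₂², u₃², u₄u₁, u₄u₂, u₄u₃)`.  Off the closed point `T` is the blowing up of the
regular centre `V(P)`; over `𝔪` it is singular in general.  COMPANION `Q = 𝔪ᴺ`, `N = n(a-1)+1`:
`I · 𝔪ᴺ = P · 𝔪ᵃ⁺ᴺ` (r1a's pigeonhole multiplied by `P`), and

  `Bl_{P·𝔪ᴹ} Spec S = Bl_{F}(Bl_P Spec S)`, `F = ` the closed fibre ` ≅ ℙʳ_κ`,

is REGULAR: `Bl_P Spec S` is regular (Liu 8.1.19 (a), tree `affineBlowup.isRegular_of_isQuasiRegular`),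
its closed fibre is the projective space `ℙʳ_κ` over the residue field (the exceptional divisor
is `ℙʳ` over the centre, Liu 8.1.19 (b), tree `isPullback_exceptional_projectiveSpace`, base
changed to the closed point with `isPullback_projMap'`), hence a regular centre, and blowing up a
regular centre keeps regularity (Liu 8.1.19 (a), tree `IsBlowup.isRegular_of_isRegular_subscheme`);
the composite is a blowing up along `(P·𝔪ᴹ)~` (Stacks 080A).

Results: `isRegular_subscheme_comap_maximalIdeal_affineBlowup` (closed fibre of `Bl_P` is
regular), `isRegular_subscheme_comap_maximalIdeal_of_isBlowup` (same for any blowing up along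
`P̃`), `isBlowup_comp_span_mul_pow_maximalIdeal`, `isRegular_of_isBlowup_span_mul_pow_maximalIdeal`,
`isRegular_of_isBlowup_rsopPart_mul_pow_maximalIdeal` (**`Bl_{P·𝔪ᴹ}` regular**),
`CoreRung.mul_pow_eq_mul_pow_of_sandwich`, and the rungs `coreRung_of_sandwich_linearCentre`,
`coreRung_of_sandwich_rsopPart`.  Every dimension, every regular local base; BC5-type evidence
for the core, outside the toric machinery.  Nothing here is a statement of the manuscript under
review.

## References

* Q. Liu, *Algebraic Geometry and Arithmetic Curves*, OUP 2002, Thm. 8.1.19 (a), (b). [Liu2002]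
* The Stacks Project, Tag 080A. [StacksProject]
* H. Matsumura, *Commutative Ring Theory*, CUP 1986, Thm. 14.2, Thm. 16.2. [Matsumura1987]
-/

-- `Summit.<Summit>.<Sub>.Theorems` with `Sub = Summit` (single-conjunct summit, D-0017)
set_option linter.dupNamespace false

noncomputable section

open CategoryTheory CategoryTheory.Limits AlgebraicGeometry Literature.AlgebraicGeometry.Resolution
open Literature.AlgebraicGeometry.Motives Literature.AlgebraicGeometry.Motives.ProjBaseChangeRing

namespace Summit.ResolutionOfSingularities.ResolutionOfSingularities.Theorems

universe u

/-- **The closed fibre of the model blowing up of a local scheme along a quasi-regular sequence is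
regular**: for `S` local, `x = (x₀, …, x_r)` quasi-regular with `P = (x) ⊆ 𝔪`, the closed
subscheme `V(𝔪 · 𝒪_{Bl})` of `Bl = Bl_P Spec S` is `ℙʳ_κ`, `κ = S/𝔪` (the exceptional divisor is
`ℙʳ` over the centre `Spec S/P`, tree `isPullback_exceptional_projectiveSpace`, base-changed to
the closed point), hence regular. [cite: Liu2002, Thm. 8.1.19 (b)] -/
theorem isRegular_subscheme_comap_maximalIdeal_affineBlowup {S : Type u} [CommRing S]
    [IsLocalRing S] {r : ℕ} (x : Fin (r + 1) → S) (hx : IsQuasiRegular x)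
    (hP : Ideal.span (Set.range x) ≤ IsLocalRing.maximalIdeal S) :
    Scheme.IsRegular ((affineBlowup.idealSheaf (IsLocalRing.maximalIdeal S)).comap
      (affineBlowup.π (Ideal.span (Set.range x)))).subscheme := by
  -- the centre `T = Spec S/P ↪ Spec S` and the closed point `Spec κ ↪ T ↪ Spec S`
  let jP : Spec (.of (S ⧸ Ideal.span (Set.range x))) ⟶ Spec (.of S) :=
    Spec.map (CommRingCat.ofHom (Ideal.Quotient.mk (Ideal.span (Set.range x))))
  haveI : IsClosedImmersion jP :=
    IsClosedImmersion.spec_of_surjective _ Ideal.Quotient.mk_surjective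
  have hj : jP.ker = affineBlowup.idealSheaf (Ideal.span (Set.range x)) :=
    ker_specMap_quotient_mk _
  let jm : Spec (.of (S ⧸ IsLocalRing.maximalIdeal S)) ⟶ Spec (.of S) :=
    Spec.map (CommRingCat.ofHom (Ideal.Quotient.mk (IsLocalRing.maximalIdeal S)))
  haveI : IsClosedImmersion jm :=
    IsClosedImmersion.spec_of_surjective _ Ideal.Quotient.mk_surjective
  let q : Spec (.of (S ⧸ IsLocalRing.maximalIdeal S)) ⟶ Spec (.of (S ⧸ Ideal.span (Set.range x))) :=
    Spec.map (CommRingCat.ofHom (Ideal.Quotient.factor hP))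
  have hqj : q ≫ jP = jm := by
    simp only [q, jP, jm]
    rw [← Spec.map_comp, ← CommRingCat.ofHom_comp, Ideal.Quotient.factor_comp_mk]
  have halg : Spec.map (CommRingCat.ofHom (algebraMap S (S ⧸ IsLocalRing.maximalIdeal S))) = jm := by
    rfl
  -- the fibre `F' = E ×_T Spec κ` of the exceptional divisor `E = Bl ×_S T` is `ℙʳ_κ`
  set πB := affineBlowup.π (Ideal.span (Set.range x)) with hπB
  have Hex := isPullback_exceptional_projectiveSpace x jP hj hx
  have Hq := IsPullback.of_hasPullback (pullback.snd πB jP) q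
  have HF := Hq.paste_horiz Hex
  rw [hqj] at HF
  have Hκ := isPullback_projMap' S (S ⧸ IsLocalRing.maximalIdeal S) (n := r)
  rw [halg] at Hκ
  have e1 := HF.isoIsPullback _ _ Hκ
  have hregF : Scheme.IsRegular (pullback (pullback.snd πB jP) q) := by
    letI : Field (S ⧸ IsLocalRing.maximalIdeal S) :=
      inferInstanceAs (Field (IsLocalRing.ResidueField S))
    exact SectionAscent.TraceIdeal.isRegular_of_iso e1
      (isRegular_projectiveSpace r (S ⧸ IsLocalRing.maximalIdeal S))
  -- `F'` is the pullback of `πB` along `Spec κ → Spec S`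
  have HF2 := Hq.paste_horiz (IsPullback.of_hasPullback πB jP)
  rw [hqj] at HF2
  -- the closed subscheme `V(𝔪 𝒪_{Bl})` is the pullback of `πB` along `V(𝔪) ↪ Spec S ≅ Spec κ`
  set V : (Spec (.of S)).IdealSheafData := affineBlowup.idealSheaf (IsLocalRing.maximalIdeal S)
    with hV
  have HV := isPullback_subschemeMap πB V
  have hker : V.subschemeι.ker = jm.ker := by
    rw [Scheme.IdealSheafData.ker_subschemeι, hV, ker_specMap_quotient_mk]
  let l := IsClosedImmersion.lift V.subschemeι jm hker.le
  haveI : IsIso l := IsClosedImmersion.isIso_lift _ jm hker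
  have hl : l ≫ V.subschemeι = jm := IsClosedImmersion.lift_fac _ _ _
  have HV' : IsPullback (V.comap πB).subschemeι
      (Scheme.IdealSheafData.subschemeMap (V.comap πB) V πB (V.le_map_comap πB) ≫ inv l) πB jm := by
    refine HV.flip.of_iso (Iso.refl _) (Iso.refl _) (asIso l).symm (Iso.refl _) ?_ ?_ ?_ ?_
    · simp
    · simp
    · simp
    · rw [Iso.refl_hom, Category.comp_id, Iso.symm_hom, asIso_inv, IsIso.eq_inv_comp, hl]
  have e2 : (V.comap πB).subscheme ≅ pullback (pullback.snd πB jP) q := HV'.isoIsPullback _ _ HF2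
  exact SectionAscent.TraceIdeal.isRegular_of_iso e2 hregF


/-- **The closed fibre of ANY blowing up of a local scheme along a quasi-regular `P ⊆ 𝔪` is
regular** (transport of `isRegular_subscheme_comap_maximalIdeal_affineBlowup` along the
uniqueness isomorphism of blowing ups). [cite: Liu2002, Thm. 8.1.19 (b)] -/
theorem isRegular_subscheme_comap_maximalIdeal_of_isBlowup {S : Type u} [CommRing S]
    [IsLocalRing S] {r : ℕ} (x : Fin (r + 1) → S) (hx : IsQuasiRegular x)
    (hP : Ideal.span (Set.range x) ≤ IsLocalRing.maximalIdeal S) {X' : Scheme.{u}}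
    {π : X' ⟶ Spec (.of S)} (hπ : IsBlowup π (affineBlowup.idealSheaf (Ideal.span (Set.range x)))) :
    Scheme.IsRegular ((affineBlowup.idealSheaf (IsLocalRing.maximalIdeal S)).comap π).subscheme := by
  obtain ⟨e, he, -⟩ := hπ.unique (affineBlowup.isBlowup (Ideal.span (Set.range x)))
  have hreg := isRegular_subscheme_comap_maximalIdeal_affineBlowup x hx hP
  rw [← he, Scheme.IdealSheafData.comap_comp]
  exact Scheme.IsRegular.of_isOpenImmersion
    (Scheme.IdealSheafData.subschemeMap _ _ e.hom
      (((affineBlowup.idealSheaf (IsLocalRing.maximalIdeal S)).comap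
        (affineBlowup.π (Ideal.span (Set.range x)))).le_map_comap e.hom)) hreg

/-- **A blowing up of a local scheme along a quasi-regular `P ⊆ 𝔪` followed by the blowing up of
the closed fibre is a blowing up along `(P · 𝔪ᴹ)~` for every `M ≥ 1`** (Stacks 080A, with the
exceptional ideal `𝔪 𝒪` Cartier upstairs for the extra powers). [cite: StacksProject, Tag 080A] -/
theorem isBlowup_comp_span_mul_pow_maximalIdeal {S : Type u} [CommRing S] [IsLocalRing S]
    (P : Ideal S) {X' X'' : Scheme.{u}} {π : X' ⟶ Spec (.of S)}
    (hπ : IsBlowup π (affineBlowup.idealSheaf P)) {π' : X'' ⟶ X'}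
    (hπ' : IsBlowup π' ((affineBlowup.idealSheaf (IsLocalRing.maximalIdeal S)).comap π))
    (M : ℕ) (hM : 0 < M) :
    IsBlowup (π' ≫ π) (affineBlowup.idealSheaf (P * IsLocalRing.maximalIdeal S ^ M)) := by
  induction M with
  | zero => exact absurd hM (lt_irrefl 0)
  | succ M ih =>
    rcases Nat.eq_zero_or_pos M with h0 | hpos
    · subst h0
      rw [zero_add, pow_one, affineBlowup.idealSheaf_mul]
      exact hπ.comp hπ'
    · have h1 := ih hpos
      have hE : IsEffectiveCartier
          ((affineBlowup.idealSheaf (IsLocalRing.maximalIdeal S)).comap (π' ≫ π)) := by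
        rw [Scheme.IdealSheafData.comap_comp]
        exact hπ'.isEffectiveCartier
      have h2 := h1.comp (IsBlowup.id hE)
      rw [Category.id_comp, ← affineBlowup.idealSheaf_mul, mul_assoc, ← pow_succ] at h2
      exact h2

/-- **`Bl_{P·𝔪ᴹ} Spec S` is regular** for `S` a regular local ring, `P = (x₀, …, x_r) ⊆ 𝔪`
generated by a quasi-regular sequence with `S/P` regular (e.g. part of a regular system of
parameters), `M ≥ 1`: it is the blowing up of the regular scheme `Bl_P Spec S` (Liu 8.1.19 (a),
tree `affineBlowup.isRegular_of_isQuasiRegular`) along its closed fibre `ℙʳ_κ`, a regular centre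
(`isRegular_subscheme_comap_maximalIdeal_affineBlowup` + Liu 8.1.19 (a),
tree `IsBlowup.isRegular_of_isRegular_subscheme`). [cite: Liu2002, Thm. 8.1.19 (a), (b)]
[cite: StacksProject, Tag 080A] -/
theorem isRegular_of_isBlowup_span_mul_pow_maximalIdeal {S : Type u} [CommRing S]
    [IsRegularLocalRing S] {r : ℕ} (x : Fin (r + 1) → S) (hx : IsQuasiRegular x)
    [IsRegularRing (S ⧸ Ideal.span (Set.range x))]
    (hP : Ideal.span (Set.range x) ≤ IsLocalRing.maximalIdeal S) (M : ℕ) (hM : 0 < M)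
    {B : Scheme.{u}} {b : B ⟶ Spec (.of S)}
    (hb : IsBlowup b (affineBlowup.idealSheaf
      (Ideal.span (Set.range x) * IsLocalRing.maximalIdeal S ^ M))) :
    Scheme.IsRegular B := by
  haveI : IsRegularRing S := isRegularRing_of_isRegularLocalRing S
  have hB0 := affineBlowup.isBlowup (Ideal.span (Set.range x))
  have hX' : Scheme.IsRegular (affineBlowup (Ideal.span (Set.range x))) :=
    affineBlowup.isRegular_of_isQuasiRegular x hx
  haveI : IsNoetherianRing (CommRingCat.of S) := (inferInstance : IsNoetherianRing S)
  haveI : IsLocallyNoetherian (affineBlowup (Ideal.span (Set.range x))) := by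
    haveI : IsProper (affineBlowup.π (Ideal.span (Set.range x))) := hB0.isProper
    exact LocallyOfFiniteType.isLocallyNoetherian (affineBlowup.π (Ideal.span (Set.range x)))
  obtain ⟨X'', π', hπ'⟩ := exists_isBlowup (affineBlowup (Ideal.span (Set.range x)))
    ((affineBlowup.idealSheaf (IsLocalRing.maximalIdeal S)).comap
      (affineBlowup.π (Ideal.span (Set.range x))))
  have hreg : Scheme.IsRegular X'' :=
    hπ'.isRegular_of_isRegular_subscheme hX'
      (isRegular_subscheme_comap_maximalIdeal_affineBlowup x hx hP)
  have hcomp := isBlowup_comp_span_mul_pow_maximalIdeal (Ideal.span (Set.range x)) hB0 hπ' M hM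
  obtain ⟨e, -, -⟩ := hb.unique hcomp
  exact SectionAscent.TraceIdeal.isRegular_of_iso e hreg

/-- **Sandwich one centre up** (algebra): if `(u₁ᵃ, …, u_nᵃ) · P ⊆ I ⊆ 𝔪ᵃ · P` with
`𝔪 = (u₁, …, u_n)` and `n (a - 1) < a + N`, then `I · 𝔪ᴺ = P · 𝔪ᵃ⁺ᴺ` (multiply the pigeonhole
`CoreRung.span_powers_mul_pow_eq_pow` by `P`). [folklore] -/
theorem CoreRung.mul_pow_eq_mul_pow_of_sandwich {S : Type u} [CommRing S] {n : ℕ}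
    (u : Fin n → S) {𝔪 : Ideal S} (hu : Ideal.span (Set.range u) = 𝔪) {I P : Ideal S} {a N : ℕ}
    (h : n * (a - 1) < a + N) (hle : I ≤ 𝔪 ^ a * P)
    (hge : Ideal.span (Set.range fun j => u j ^ a) * P ≤ I) : I * 𝔪 ^ N = P * 𝔪 ^ (a + N) := by
  apply le_antisymm
  · calc I * 𝔪 ^ N ≤ 𝔪 ^ a * P * 𝔪 ^ N := Ideal.mul_mono_left hle
      _ = P * 𝔪 ^ (a + N) := by rw [pow_add]; ring
  · calc P * 𝔪 ^ (a + N) = Ideal.span (Set.range fun j => u j ^ a) * P * 𝔪 ^ N := by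
          rw [← CoreRung.span_powers_mul_pow_eq_pow u hu h]; ring
      _ ≤ I * 𝔪 ^ N := Ideal.mul_mono_left hge

/-- **CORE RUNG r1b (one linear centre up).** Let `S` be regular local, `𝔪 = (u₁, …, u_n)`,
`P = (x₀, …, x_r) ⊆ 𝔪` generated by a quasi-regular sequence with `S/P` regular (e.g. `x` part of
a regular system of parameters), and `I ≠ 0` an ideal with `(u₁ᵃ, …, u_nᵃ) · P ⊆ I ⊆ 𝔪ᵃ · P`.
Then every blowing up `T = Bl_I Spec S` satisfies the conclusion of the blow-up-form open core
`AtomDimFourBlowupAt`: companion `Q = 𝔪ᴺ`, `N = n(a-1)+1`, since `I · Q = P · 𝔪ᵃ⁺ᴺ` and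
`Bl_{P·𝔪ᵃ⁺ᴺ} = Bl_{ℙʳ_κ}(Bl_P Spec S)` is regular.  Here `T` is NOT an isomorphism off the closed
point (over `V(P) ∖ {𝔪}` it is the blowing up of the regular centre `V(P)`), and is singular over
`𝔪` in general (e.g. `n = 4`, `P = (u₁, u₂, u₃)`, `a = 1`,
`I = (u₁², u₂², u₃², u₄u₁, u₄u₂, u₄u₃)`): BC5-type evidence for the core with the hypothesis
"regular off the closed fibre" exercised non-vacuously; every dimension, every regular local
base. [cite: Liu2002, Thm. 8.1.19 (a), (b)] [cite: StacksProject, Tag 080A] -/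
theorem coreRung_of_sandwich_linearCentre {S : Type u} [CommRing S] [IsRegularLocalRing S]
    {n : ℕ} (u : Fin n → S) (hu : Ideal.span (Set.range u) = IsLocalRing.maximalIdeal S)
    {r : ℕ} (x : Fin (r + 1) → S) (hx : IsQuasiRegular x)
    [IsRegularRing (S ⧸ Ideal.span (Set.range x))]
    (hP : Ideal.span (Set.range x) ≤ IsLocalRing.maximalIdeal S) {I : Ideal S} {a : ℕ}
    (hle : I ≤ IsLocalRing.maximalIdeal S ^ a * Ideal.span (Set.range x))
    (hge : Ideal.span (Set.range fun j => u j ^ a) * Ideal.span (Set.range x) ≤ I) (hI : I ≠ ⊥)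
    (T : Scheme.{u}) (f : T ⟶ Spec (.of S)) (hf : IsBlowup f (affineBlowup.idealSheaf I)) :
    ∃ (J : T.IdealSheafData) (T' : Scheme.{u}) (π : T' ⟶ T), J ≠ ⊥ ∧
      (∀ t : T, t ∈ J.support → f.base t = IsLocalRing.closedPoint S) ∧
      IsBlowup π J ∧ Scheme.IsRegular T' := by
  by_cases hm : IsLocalRing.maximalIdeal S = ⊥
  · exact coreRung_of_maximalIdeal_eq_bot hm hI T f hf
  · haveI : IsDomain S := isDomain_of_isRegularLocalRing S
    have hQ : IsLocalRing.maximalIdeal S ^ (n * (a - 1) + 1) ≠ ⊥ := by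
      rw [Ne, ← Submodule.zero_eq_bot]
      exact pow_ne_zero _ (fun h => hm (h.trans Submodule.zero_eq_bot))
    have hIQ := CoreRung.mul_pow_eq_mul_pow_of_sandwich u hu (P := Ideal.span (Set.range x))
      (a := a) (N := n * (a - 1) + 1) (by omega) hle hge
    exact atomConclusion_of_mul_eq_of_forall_isRegular hIQ hI hQ le_rfl
      (fun B b hb => isRegular_of_isBlowup_span_mul_pow_maximalIdeal x hx hP
        (a + (n * (a - 1) + 1)) (by omega) hb) T f hf

/-- **`Bl_{P·𝔪ᴹ} Spec S` is regular for `P` generated by part of a regular system of parameters**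
of the regular local ring `S` (`M ≥ 1`). [cite: Liu2002, Thm. 8.1.19 (a), (b)]
[cite: Matsumura1987, Thm. 16.2] -/
theorem isRegular_of_isBlowup_rsopPart_mul_pow_maximalIdeal {S : Type u} [CommRing S]
    [IsRegularLocalRing S] {r : ℕ} {x : Fin (r + 1) → S} (hz : IsRsopPart x) (M : ℕ) (hM : 0 < M)
    {B : Scheme.{u}} {b : B ⟶ Spec (.of S)}
    (hb : IsBlowup b (affineBlowup.idealSheaf
      (Ideal.span (Set.range x) * IsLocalRing.maximalIdeal S ^ M))) :
    Scheme.IsRegular B := by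
  haveI : IsRegularRing (S ⧸ Ideal.span (Set.range x)) := by
    haveI := hz.isRegularLocalRing_quotient
    exact isRegularRing_of_isRegularLocalRing _
  exact isRegular_of_isBlowup_span_mul_pow_maximalIdeal x hz.isQuasiRegular
    hz.span_range_le_maximalIdeal M hM hb

/-- **CORE RUNG r1b for `P` part of a regular system of parameters** (the intended case:
`S` regular local of dimension `4`, `P = (u₁, u₂, u₃)`, `(u₁ᵃ, …, u₄ᵃ) · P ⊆ I ⊆ 𝔪ᵃ · P`).
[cite: Liu2002, Thm. 8.1.19 (a), (b)] [cite: StacksProject, Tag 080A] -/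
theorem coreRung_of_sandwich_rsopPart {S : Type u} [CommRing S] [IsRegularLocalRing S]
    {n : ℕ} (u : Fin n → S) (hu : Ideal.span (Set.range u) = IsLocalRing.maximalIdeal S)
    {r : ℕ} {x : Fin (r + 1) → S} (hz : IsRsopPart x) {I : Ideal S} {a : ℕ}
    (hle : I ≤ IsLocalRing.maximalIdeal S ^ a * Ideal.span (Set.range x))
    (hge : Ideal.span (Set.range fun j => u j ^ a) * Ideal.span (Set.range x) ≤ I) (hI : I ≠ ⊥)
    (T : Scheme.{u}) (f : T ⟶ Spec (.of S)) (hf : IsBlowup f (affineBlowup.idealSheaf I)) :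
    ∃ (J : T.IdealSheafData) (T' : Scheme.{u}) (π : T' ⟶ T), J ≠ ⊥ ∧
      (∀ t : T, t ∈ J.support → f.base t = IsLocalRing.closedPoint S) ∧
      IsBlowup π J ∧ Scheme.IsRegular T' := by
  haveI : IsRegularRing (S ⧸ Ideal.span (Set.range x)) := by
    haveI := hz.isRegularLocalRing_quotient
    exact isRegularRing_of_isRegularLocalRing _
  exact coreRung_of_sandwich_linearCentre u hu x hz.isQuasiRegular hz.span_range_le_maximalIdeal
    hle hge hI T f hf

/-! ## Appendix: equation form and the regular-system-of-parameters instantiation -/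

/-- **CORE RUNG r1b, equation form**: `S` regular local, `P = (x₀, …, x_r)` part of a regular
system of parameters, `I ≠ 0` with `I · 𝔪ᴺ = P · 𝔪ᴹ` for some `N` and `M ≥ 1` ⇒ every blowing
up `T = Bl_I Spec S` satisfies the atom's conclusion (companion `𝔪ᴺ`).  This form is closed under
products with rung r1a: if `I₁ · 𝔪^{N₁} = 𝔪^{d}` and `I₂ · 𝔪^{N₂} = P · 𝔪^{M}` then
`(I₁ I₂) · 𝔪^{N₁+N₂} = P · 𝔪^{d+M}`. [cite: Liu2002, Thm. 8.1.19 (a), (b)]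
[cite: StacksProject, Tag 080A] -/
theorem coreRung_of_mul_pow_eq_rsopPart_mul_pow {S : Type u} [CommRing S] [IsRegularLocalRing S]
    {r : ℕ} {x : Fin (r + 1) → S} (hz : IsRsopPart x) {I : Ideal S} {N M : ℕ} (hM : 0 < M)
    (hIN : I * IsLocalRing.maximalIdeal S ^ N =
      Ideal.span (Set.range x) * IsLocalRing.maximalIdeal S ^ M)
    (hI : I ≠ ⊥) (T : Scheme.{u}) (f : T ⟶ Spec (.of S))
    (hf : IsBlowup f (affineBlowup.idealSheaf I)) :
    ∃ (J : T.IdealSheafData) (T' : Scheme.{u}) (π : T' ⟶ T), J ≠ ⊥ ∧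
      (∀ t : T, t ∈ J.support → f.base t = IsLocalRing.closedPoint S) ∧
      IsBlowup π J ∧ Scheme.IsRegular T' := by
  by_cases hm : IsLocalRing.maximalIdeal S = ⊥
  · exact coreRung_of_maximalIdeal_eq_bot hm hI T f hf
  · haveI : IsDomain S := isDomain_of_isRegularLocalRing S
    have hQ : IsLocalRing.maximalIdeal S ^ N ≠ ⊥ := by
      rw [Ne, ← Submodule.zero_eq_bot]
      exact pow_ne_zero _ (fun h => hm (h.trans Submodule.zero_eq_bot))
    exact atomConclusion_of_mul_eq_of_forall_isRegular hIN hI hQ le_rfl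
      (fun B b hb => isRegular_of_isBlowup_rsopPart_mul_pow_maximalIdeal hz M hM hb) T f hf

/-- **Products of an r1a member and an r1b member are r1b members** (equation form):
`I₁ · 𝔪^{N₁} = 𝔪^{d}` and `I₂ · 𝔪^{N₂} = P · 𝔪^{M}` give `(I₁ I₂) · 𝔪^{N₁+N₂} = P · 𝔪^{d+M}`.
[folklore] -/
theorem CoreRung.mul_mul_pow_eq_of_eq_of_eq {S : Type u} [CommRing S] {I₁ I₂ P 𝔪 : Ideal S}
    {N₁ N₂ d M : ℕ} (h₁ : I₁ * 𝔪 ^ N₁ = 𝔪 ^ d) (h₂ : I₂ * 𝔪 ^ N₂ = P * 𝔪 ^ M) :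
    I₁ * I₂ * 𝔪 ^ (N₁ + N₂) = P * 𝔪 ^ (d + M) := by
  calc I₁ * I₂ * 𝔪 ^ (N₁ + N₂) = (I₁ * 𝔪 ^ N₁) * (I₂ * 𝔪 ^ N₂) := by rw [pow_add]; ring
    _ = P * 𝔪 ^ (d + M) := by rw [h₁, h₂, pow_add]; ring

/-- **CORE RUNG r1b instantiated on a regular system of parameters** (the dimension-`4` atom's
`S ≅ κ[[u₁, …, u₄]]` with `P = (u_{ι 0}, …, u_{ι r})` for an injective `ι`): `u` a regular
system of parameters of `S` generating `𝔪`, `(u₁ᵃ, …, u_nᵃ) · P ⊆ I ⊆ 𝔪ᵃ · P`, `I ≠ 0`.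
[cite: Liu2002, Thm. 8.1.19 (a), (b)] [cite: Matsumura1987, Thm. 16.2] -/
theorem coreRung_of_sandwich_rsop_comp {S : Type u} [CommRing S] [IsRegularLocalRing S]
    {n : ℕ} {u : Fin n → S} (hu : IsRsopPart u)
    (hgen : Ideal.span (Set.range u) = IsLocalRing.maximalIdeal S) {r : ℕ}
    (ι : Fin (r + 1) → Fin n) (hι : Function.Injective ι) {I : Ideal S} {a : ℕ}
    (hle : I ≤ IsLocalRing.maximalIdeal S ^ a * Ideal.span (Set.range (u ∘ ι)))
    (hge : Ideal.span (Set.range fun j => u j ^ a) * Ideal.span (Set.range (u ∘ ι)) ≤ I)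
    (hI : I ≠ ⊥) (T : Scheme.{u}) (f : T ⟶ Spec (.of S))
    (hf : IsBlowup f (affineBlowup.idealSheaf I)) :
    ∃ (J : T.IdealSheafData) (T' : Scheme.{u}) (π : T' ⟶ T), J ≠ ⊥ ∧
      (∀ t : T, t ∈ J.support → f.base t = IsLocalRing.closedPoint S) ∧
      IsBlowup π J ∧ Scheme.IsRegular T' :=
  coreRung_of_sandwich_rsopPart u hgen (hu.comp ι hι) hle hge hI T f hf

end Summit.ResolutionOfSingularities.ResolutionOfSingularities.Theorems

end
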